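import Summits.RiemannHypothesis.RiemannHypothesis.Theses.WeilComb
import Summits.RiemannHypothesis.RiemannHypothesis.Theorems.WeilCombCombShapeDetection
import Summits.RiemannHypothesis.RiemannHypothesis.Theorems.WeilCombCombShapeAdmissible
import Summits.RiemannHypothesis.RiemannHypothesis.Theorems.WeilCombCombShapePositivityStubDilationLandau
import Literature.NumberTheory.LFunctions.WeilCriterionConverse
import Literature.NumberTheory.LFunctions.WeilExplicitFormulaProofs
import Literature.NumberTheory.LFunctions.WeilExplicitProofs
import Literature.NumberTheory.LFunctions.WeilMellinBounds
import Literature.NumberTheory.LFunctions.WeilMellinInversion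
import Literature.NumberTheory.LFunctions.WeilDilationVirial
import Literature.NumberTheory.LFunctions.WeilZeroSum
import Literature.NumberTheory.LFunctions.LandauOscillation
import Mathlib

/-!
# Dilation detection IV — geometry of the off-line segments

stub-plan `Cruxes/CombShapePositivity/STUB-PLAN-stub_fejer.md`, tier ★T2 DILATION DETECTION
(crux `WeilComb.CombShapePositivity`, item stmt-RiemannHypothesis-11229, route route-RiemannHypothesis-WeilComb,
line `Sketch`; sprove seat). The five files `…StubDilationSeries` → `…KernelSum` → `…Landau` → `…Geometry` →
`…Detection` prove `stub_dilationDetection : (∀ ε ≥ 1, 0 ≤ Re W(φ_ε ⋆ φ̃_ε)) → RiemannHypothesis`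
(a theorem ABOUT the RH-equivalent stub `stub_fejer` — its `S = ∅` face is already RH-complete — not a step
of `CombShapePositivity_of`).

This file: normalisation of off-line zeros by `ρ ↦ ρ̄`, `ρ ↦ 1 − ρ̄` (`exists_normalised`), finiteness of
normalised zeros of bounded ratio `Im ρ/(Re ρ − ½)`, the LEAST ratio `r₀` and the next one `r₁`
(`exists_least_ratio`, registered as `offline_least_ratio`), and `seg_geometry`: every segment point with
`Re s > 0` has `|Im s| ≥ r₀ Re s` and avoids `r₀ Re s < Im s < r₁ Re s`; the two sectors (open, convex);
the splitting `G_univ = G_P + G_{Pᶜ}`; finiteness of the zeros on the least-angle line.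
-/

noncomputable section

-- the sub-problem path RiemannHypothesis/RiemannHypothesis duplicates a namespace (D-0017)
set_option linter.dupNamespace false

open scoped BigOperators ComplexConjugate Real Topology
open Complex MeasureTheory Set Filter

namespace Summit.RiemannHypothesis.RiemannHypothesis.Theorems.WeilCombBohrFejer

open Literature.NumberTheory.LFunctions
open Literature.NumberTheory.LFunctions.WeilConverse

/-! ## Notation (local, purely syntactic abbreviations of sub-terms of the registered stubs) -/

/-- the route bump `φ_ε(t) = ε⁻¹ φ₀(t/ε)` (verbatim sub-term of the registered stubs). -/
local notation "φb(" ε ")" =>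
  (fun t : ℝ => ((ε : ℝ) : ℂ)⁻¹ * ((expNegInvGlue (1 - (t / ε) ^ 2) : ℝ) : ℂ))

/-- the fixed bump as a complex function `φ₀ℂ(u) = expNegInvGlue (1 - u²)`. -/
local notation "φ₀ℂ" => (fun u : ℝ => ((expNegInvGlue (1 - u ^ 2) : ℝ) : ℂ))

/-- its entire transform `Φ₀(z) = ∫ φ₀(u) e^{zu} du`. -/
local notation "Φ₀(" z ")" =>
  (∫ u : ℝ, ((expNegInvGlue (1 - u ^ 2) : ℝ) : ℂ) * Complex.exp (z * u))

/-- the autocorrelation `ψ₀ = φ₀ ⋆ φ₀`. -/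
local notation "ψ₀(" t ")" =>
  (∫ u : ℝ, expNegInvGlue (1 - u ^ 2) * expNegInvGlue (1 - (t - u) ^ 2))

/-- the Cauchy–Laplace kernel of `ψ₀`: `K(w, s) = ∫_{-2}^{2} ψ₀(t) e^{wt − s}/(s − wt) dt`. -/
local notation "Kψ(" w ", " s ")" =>
  (∫ t in (-2 : ℝ)..2, (((∫ u : ℝ, expNegInvGlue (1 - u ^ 2) * expNegInvGlue (1 - (t - u) ^ 2)) : ℝ) : ℂ) *
    Complex.exp (w * t - s) / (s - w * t))

/-- the set of non-trivial zeros (subtype). -/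
local notation "𝒵" => ZetaZeros.riemannZetaNontrivialZeros

/-- `g(x) = Re Q(φ_{log x})` for `x > e`, `0` otherwise — the non-negative function of Landau's
lemma, in the multiplicative variable `x = e^ε`. Written with `max 1 (log x)` so that measurability
is immediate. -/
local notation "gL" =>
  (Set.indicator (Set.Ioi (Real.exp 1)) (fun x : ℝ => Complex.re (weilQuadratic φb(max 1 (Real.log x)))))

/-- the kernel attached to a complex number `ρ'` (weighted by the multiplicity) restricted to a
set `P` of zeros. -/
local notation "KP(" P ", " ρ' ", " s ")" =>
  (Set.indicator P (fun ρ'' : ℂ => (riemannZetaZeroOrder ρ'' : ℂ) * Kψ(ρ'' - 1 / 2, s)) ρ')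

/-- the zero sum of kernels over the zeros in `P`: `G_P(s) = Σ_{ρ ∈ P} m(ρ) K(ρ − ½, s)`. -/
local notation "GK(" P ", " s ")" => (∑' ρ : 𝒵, KP(P, (ρ : ℂ), s))

set_option quotPrecheck false in
/-- the natural domain of `G_P`: the right half-plane minus the segments `(ρ − ½)·[−2, 2]` of the
zeros `ρ ∈ P` (segments of on-line zeros lie on the imaginary axis and are excluded for free). -/
local notation "UP(" P ")" =>
  (setOf fun s : ℂ => 0 < Complex.re s ∧ ∀ ρ' : ℂ, ρ' ∈ P → ρ' ∈ ZetaZeros.riemannZetaNontrivialZeros →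
    ∀ t : ℝ, t ∈ Set.Icc (-2 : ℝ) 2 → s ≠ (ρ' - 1 / 2) * t)

/-! ## B3 · bookkeeping of off-line zeros: normalisation, least ratio, next ratio -/

/-- Normalisation by the symmetries `ρ ↦ ρ̄`, `ρ ↦ 1 − ρ̄`: every off-line zero has a companion
zero `ρ'` with `Re ρ' − ½ = |Re ρ − ½|` and `Im ρ' = |Im ρ|`. [folklore] -/
theorem exists_normalised {ρ : ℂ} (hρ : ρ ∈ 𝒵) (hoff : ρ.re ≠ 1 / 2) :
    ∃ ρ' : ℂ, ρ' ∈ 𝒵 ∧ ρ'.re - 1 / 2 = |ρ.re - 1 / 2| ∧ ρ'.im = |ρ.im| := by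
  have hγ : ρ.im ≠ 0 := ZetaZeros.riemannZetaNontrivialZeros.im_ne_zero hρ
  rcases lt_or_gt_of_ne (sub_ne_zero.2 hoff) with ha | ha
  · -- `Re ρ < ½`: reflect
    rcases lt_or_gt_of_ne hγ with hg | hg
    · refine ⟨conj (1 - conj ρ), ZetaZeros.riemannZetaNontrivialZeros.conj_mem
        (ZetaZeros.riemannZetaNontrivialZeros.one_sub_conj_mem hρ), ?_, ?_⟩
      · rw [abs_of_neg ha]; simp; ring
      · rw [abs_of_neg hg]; simp
    · refine ⟨1 - conj ρ, ZetaZeros.riemannZetaNontrivialZeros.one_sub_conj_mem hρ, ?_, ?_⟩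
      · rw [abs_of_neg ha]; simp; ring
      · rw [abs_of_pos hg]; simp
  · rcases lt_or_gt_of_ne hγ with hg | hg
    · refine ⟨conj ρ, ZetaZeros.riemannZetaNontrivialZeros.conj_mem hρ, ?_, ?_⟩
      · rw [abs_of_pos ha]; simp
      · rw [abs_of_neg hg]; simp
    · exact ⟨ρ, hρ, by rw [abs_of_pos ha], by rw [abs_of_pos hg]⟩

/-- Normalised zeros (`Re ρ > ½`, `Im ρ > 0`) of ratio `Im ρ/(Re ρ − ½) ≤ M` are finitely many
(their ordinates are `≤ |M|/2`). [folklore] -/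
theorem finite_ratio_le (M : ℝ) :
    {ρ : 𝒵 | 1 / 2 < (ρ : ℂ).re ∧ 0 < (ρ : ℂ).im ∧
      (ρ : ℂ).im / ((ρ : ℂ).re - 1 / 2) ≤ M}.Finite := by
  refine (finite_zeros_abs_im_le (|M| / 2)).subset fun ρ hρ => ?_
  obtain ⟨h1, h2, h3⟩ := hρ
  have ha : 0 < (ρ : ℂ).re - 1 / 2 := by linarith
  have ha' : (ρ : ℂ).re - 1 / 2 < 1 / 2 := by
    linarith [ZetaZeros.riemannZetaNontrivialZeros.re_lt_one ρ.2]
  show |(ρ : ℂ).im| ≤ |M| / 2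
  rw [abs_of_pos h2]
  have h4 : (ρ : ℂ).im ≤ M * ((ρ : ℂ).re - 1 / 2) := (div_le_iff₀ ha).1 h3
  have h5 : M * ((ρ : ℂ).re - 1 / 2) ≤ |M| * ((ρ : ℂ).re - 1 / 2) :=
    mul_le_mul_of_nonneg_right (le_abs_self M) ha.le
  nlinarith [abs_nonneg M]

/-- **Least ratio.** If an off-line zero exists there is a normalised zero `ρ₀` whose ratio
`r₀ = Im ρ₀/(Re ρ₀ − ½)` is minimal among all normalised zeros, together with a next value
`r₁ > r₀` below which no other ratio occurs. [folklore] -/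
theorem exists_least_ratio {ρ : ℂ} (hρ : ρ ∈ 𝒵) (hoff : ρ.re ≠ 1 / 2) :
    ∃ ρ₀ : ℂ, ρ₀ ∈ 𝒵 ∧ 1 / 2 < ρ₀.re ∧ 0 < ρ₀.im ∧
      (∀ ρ' : ℂ, ρ' ∈ 𝒵 → 1 / 2 < ρ'.re → 0 < ρ'.im →
        ρ₀.im / (ρ₀.re - 1 / 2) ≤ ρ'.im / (ρ'.re - 1 / 2)) ∧
      ∃ r₁ : ℝ, ρ₀.im / (ρ₀.re - 1 / 2) < r₁ ∧
        ∀ ρ' : ℂ, ρ' ∈ 𝒵 → 1 / 2 < ρ'.re → 0 < ρ'.im →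
          ¬ (ρ₀.im / (ρ₀.re - 1 / 2) < ρ'.im / (ρ'.re - 1 / 2) ∧ ρ'.im / (ρ'.re - 1 / 2) < r₁) := by
  -- a normalised zero `ρ₁`
  obtain ⟨ρ₁, hρ₁, ha₁, hg₁⟩ := exists_normalised hρ hoff
  have hγ : ρ.im ≠ 0 := ZetaZeros.riemannZetaNontrivialZeros.im_ne_zero hρ
  have ha₁' : 1 / 2 < ρ₁.re := by
    have : 0 < |ρ.re - 1 / 2| := abs_pos.2 (sub_ne_zero.2 hoff)
    linarith
  have hg₁' : 0 < ρ₁.im := by rw [hg₁]; exact abs_pos.2 hγ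
  set q : 𝒵 → ℝ := fun ρ' => (ρ' : ℂ).im / ((ρ' : ℂ).re - 1 / 2) with hq
  -- least ratio over the finite set of ratios `≤ q ρ₁`
  set S : Set 𝒵 := {ρ' : 𝒵 | 1 / 2 < (ρ' : ℂ).re ∧ 0 < (ρ' : ℂ).im ∧ q ρ' ≤ q ⟨ρ₁, hρ₁⟩} with hS
  have hSfin : S.Finite := finite_ratio_le _
  have hSne : hSfin.toFinset.Nonempty := ⟨⟨ρ₁, hρ₁⟩, by
    rw [Set.Finite.mem_toFinset]; exact ⟨ha₁', hg₁', le_rfl⟩⟩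
  obtain ⟨ρ₀, hρ₀S, hmin⟩ := hSfin.toFinset.exists_min_image q hSne
  rw [Set.Finite.mem_toFinset] at hρ₀S
  obtain ⟨ha₀, hg₀, hq₀⟩ := hρ₀S
  have hmin' : ∀ ρ' : ℂ, ρ' ∈ 𝒵 → 1 / 2 < ρ'.re → 0 < ρ'.im → q ρ₀ ≤ ρ'.im / (ρ'.re - 1 / 2) := by
    intro ρ' hρ' ha' hg'
    by_cases hle : ρ'.im / (ρ'.re - 1 / 2) ≤ q ⟨ρ₁, hρ₁⟩
    · exact hmin ⟨ρ', hρ'⟩ (by rw [Set.Finite.mem_toFinset]; exact ⟨ha', hg', hle⟩)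
    · exact hq₀.trans (not_le.1 hle).le
  refine ⟨ρ₀, ρ₀.2, ha₀, hg₀, hmin', ?_⟩
  -- next ratio
  set S₁ : Set 𝒵 := {ρ' : 𝒵 | 1 / 2 < (ρ' : ℂ).re ∧ 0 < (ρ' : ℂ).im ∧ q ρ' ≤ q ρ₀ + 1} with hS₁
  have hS₁fin : S₁.Finite := finite_ratio_le _
  set S₁' : Finset 𝒵 := hS₁fin.toFinset.filter (fun ρ' => q ρ₀ < q ρ') with hS₁'
  by_cases hne : S₁'.Nonempty
  · obtain ⟨ρ₂, hρ₂, hmin₂⟩ := S₁'.exists_min_image q hne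
    rw [hS₁', Finset.mem_filter, Set.Finite.mem_toFinset] at hρ₂
    refine ⟨q ρ₂, hρ₂.2, fun ρ' hρ' ha' hg' ⟨h1, h2⟩ => ?_⟩
    have hmem : (⟨ρ', hρ'⟩ : 𝒵) ∈ S₁' := by
      rw [hS₁', Finset.mem_filter, Set.Finite.mem_toFinset]
      refine ⟨⟨ha', hg', ?_⟩, h1⟩
      have : q ρ₂ ≤ q ρ₀ + 1 := hρ₂.1.2.2
      show ρ'.im / (ρ'.re - 1 / 2) ≤ q ρ₀ + 1
      linarith
    have := hmin₂ _ hmem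
    exact absurd h2 (not_lt.2 this)
  · refine ⟨q ρ₀ + 1, by linarith, fun ρ' hρ' ha' hg' ⟨h1, h2⟩ => hne ⟨⟨ρ', hρ'⟩, ?_⟩⟩
    rw [hS₁', Finset.mem_filter, Set.Finite.mem_toFinset]
    exact ⟨⟨ha', hg', h2.le⟩, h1⟩

/-! ## B3 · the segments avoid the two sectors adjacent to the least-angle line -/

/-- **Segment geometry.** Let `r₀` be the least normalised ratio and `(r₀, r₁)` free of ratios.
A point `s = (ρ' − ½)t` of a segment with `Re s > 0` has `|Im s| ≥ r₀ Re s`, and not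
`r₀ Re s < Im s < r₁ Re s`. [folklore] -/
theorem seg_geometry {r₀ r₁ : ℝ} (hr₀pos : 0 < r₀)
    (hr₀ : ∀ ρ' : ℂ, ρ' ∈ 𝒵 → 1 / 2 < ρ'.re → 0 < ρ'.im → r₀ ≤ ρ'.im / (ρ'.re - 1 / 2))
    (hr₁ : ∀ ρ' : ℂ, ρ' ∈ 𝒵 → 1 / 2 < ρ'.re → 0 < ρ'.im →
      ¬ (r₀ < ρ'.im / (ρ'.re - 1 / 2) ∧ ρ'.im / (ρ'.re - 1 / 2) < r₁))
    {ρ' : ℂ} (hρ' : ρ' ∈ 𝒵) {t : ℝ} {s : ℂ} (hs : s = (ρ' - 1 / 2) * t) (hre : 0 < s.re) :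
    r₀ * s.re ≤ |s.im| ∧ ¬ (r₀ * s.re < s.im ∧ s.im < r₁ * s.re) := by
  set a : ℝ := ρ'.re - 1 / 2 with ha
  set γ : ℝ := ρ'.im with hγ
  have hsre : s.re = a * t := by rw [hs]; simp [Complex.mul_re, ha]
  have hsim : s.im = γ * t := by rw [hs]; simp [Complex.mul_im, hγ]
  have hat : 0 < a * t := hsre ▸ hre
  have ha0 : a ≠ 0 := fun h => by rw [h, zero_mul] at hat; exact lt_irrefl _ hat
  have ht0 : t ≠ 0 := fun h => by rw [h, mul_zero] at hat; exact lt_irrefl _ hat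
  have hoff : ρ'.re ≠ 1 / 2 := fun h => ha0 (by rw [ha, h]; ring)
  obtain ⟨ρ'', hρ'', ha'', hg''⟩ := exists_normalised hρ' hoff
  have hapos : 0 < |a| := abs_pos.2 ha0
  have hγne : γ ≠ 0 := ZetaZeros.riemannZetaNontrivialZeros.im_ne_zero hρ'
  have h1 : 1 / 2 < ρ''.re := by linarith
  have h2 : 0 < ρ''.im := by rw [hg'']; exact abs_pos.2 hγne
  have hq := hr₀ ρ'' hρ'' h1 h2
  rw [ha'', hg'', ← ha, ← hγ, le_div_iff₀ hapos] at hq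
  have habs : |s.im| = |γ| * |t| := by rw [hsim, abs_mul]
  have hre' : s.re = |a| * |t| := by rw [hsre, ← abs_mul, abs_of_pos hat]
  refine ⟨?_, ?_⟩
  · rw [habs, hre']
    calc r₀ * (|a| * |t|) = (r₀ * |a|) * |t| := by ring
      _ ≤ |γ| * |t| := mul_le_mul_of_nonneg_right hq (abs_nonneg t)
  · rintro ⟨h3, h4⟩
    have hpos : 0 < s.im := lt_trans (mul_pos hr₀pos hre) h3
    have him : s.im = |γ| * |t| := by rw [← abs_of_pos hpos, habs]
    have hat' : 0 < |a| * |t| := by rw [← hre']; exact hre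
    have ht' : 0 < |t| := abs_pos.2 ht0
    refine hr₁ ρ'' hρ'' h1 h2 ⟨?_, ?_⟩
    · rw [ha'', hg'', ← ha, ← hγ, lt_div_iff₀ hapos]
      rw [him, hre'] at h3
      nlinarith
    · rw [ha'', hg'', ← ha, ← hγ, div_lt_iff₀ hapos]
      rw [him, hre'] at h4
      nlinarith

/-! ## B3 · sectors, the least-angle line, and the jump contradiction -/

/-- The lower sector `{Re s > 0, |Im s| < r Re s}` is open. [folklore] -/
theorem isOpen_secM (r : ℝ) : IsOpen {s : ℂ | 0 < s.re ∧ |s.im| < r * s.re} :=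
  (isOpen_lt continuous_const Complex.continuous_re).inter
    (isOpen_lt (continuous_abs.comp Complex.continuous_im) (continuous_const.mul Complex.continuous_re))

/-- The lower sector is convex. [folklore] -/
theorem convex_secM (r : ℝ) : Convex ℝ {s : ℂ | 0 < s.re ∧ |s.im| < r * s.re} := by
  have e : {s : ℂ | 0 < s.re ∧ |s.im| < r * s.re} =
      {s : ℂ | 0 < s.re} ∩ ({s : ℂ | s.im - r * s.re < 0} ∩ {s : ℂ | -s.im - r * s.re < 0}) := by
    ext s
    simp only [Set.mem_setOf_eq, Set.mem_inter_iff, abs_lt]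
    constructor
    · rintro ⟨h1, h3, h4⟩; exact ⟨h1, by linarith, by linarith⟩
    · rintro ⟨h1, h3, h4⟩; exact ⟨h1, by linarith, by linarith⟩
  rw [e]
  exact (convex_halfSpace_re_gt 0).inter ((convex_halfSpace_lt (isLinearMap_im_sub r) 0).inter
    (convex_halfSpace_lt (isLinearMap_neg_im_sub r) 0))

/-- The upper sector `{Re s > 0, r Re s < Im s < r' Re s}` is open. [folklore] -/
theorem isOpen_secP (r r' : ℝ) :
    IsOpen {s : ℂ | 0 < s.re ∧ r * s.re < s.im ∧ s.im < r' * s.re} :=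
  (isOpen_lt continuous_const Complex.continuous_re).inter
    ((isOpen_lt (continuous_const.mul Complex.continuous_re) Complex.continuous_im).inter
      (isOpen_lt Complex.continuous_im (continuous_const.mul Complex.continuous_re)))

/-- `s ↦ κ Re s − Im s` is `ℝ`-linear. [folklore] -/
theorem isLinearMap_sub_im (κ : ℝ) : IsLinearMap ℝ fun s : ℂ => κ * s.re - s.im :=
  IsLinearMap.mk (fun x y => by simp; ring) (fun c x => by simp; ring)

/-- The upper sector is convex. [folklore] -/
theorem convex_secP (r r' : ℝ) :
    Convex ℝ {s : ℂ | 0 < s.re ∧ r * s.re < s.im ∧ s.im < r' * s.re} := by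
  have e : {s : ℂ | 0 < s.re ∧ r * s.re < s.im ∧ s.im < r' * s.re} =
      {s : ℂ | 0 < s.re} ∩ ({s : ℂ | r * s.re - s.im < 0} ∩ {s : ℂ | s.im - r' * s.re < 0}) := by
    ext s
    simp only [Set.mem_setOf_eq, Set.mem_inter_iff]
    constructor
    · rintro ⟨h1, h3, h4⟩; exact ⟨h1, by linarith, by linarith⟩
    · rintro ⟨h1, h3, h4⟩; exact ⟨h1, by linarith, by linarith⟩
  rw [e]
  exact (convex_halfSpace_re_gt 0).inter ((convex_halfSpace_lt (isLinearMap_sub_im r) 0).inter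
    (convex_halfSpace_lt (isLinearMap_im_sub r') 0))

/-- `U_P` shrinks as `P` grows: a point off every segment is off the segments of `P`. [folklore] -/
theorem mem_UP_of_mem_UP_univ (P : Set ℂ) {s : ℂ} (hs : s ∈ UP(Set.univ)) : s ∈ UP(P) :=
  ⟨hs.1, fun ρ' _ hρ' t ht => hs.2 ρ' (Set.mem_univ _) hρ' t ht⟩

/-- Splitting the zero sum along a set of zeros: `G_univ = G_P + G_{Pᶜ}` off all segments. [folklore] -/
theorem GK_univ_eq_add (P : Set ℂ) {s : ℂ} (hs : s ∈ UP(Set.univ)) :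
    GK(Set.univ, s) = GK(P, s) + GK(Pᶜ, s) := by
  rw [← (summable_KP P (mem_UP_of_mem_UP_univ P hs)).tsum_add
    (summable_KP Pᶜ (mem_UP_of_mem_UP_univ Pᶜ hs))]
  refine tsum_congr fun ρ => ?_
  rw [Set.indicator_univ, ← Pi.add_apply (P.indicator _) (Pᶜ.indicator _), Set.indicator_self_add_compl]

/-- On a finite family: if every zero of `P` lies in the finite set `L`, then `G_P` is the finite sum
over `L`. [folklore] -/
theorem GK_eq_sum (P : Set ℂ) (L : Finset 𝒵) (hL : ∀ ρ : 𝒵, (ρ : ℂ) ∈ P → ρ ∈ L) (s : ℂ) :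
    GK(P, s) = ∑ ρ ∈ L, KP(P, (ρ : ℂ), s) := by
  refine tsum_eq_sum fun ρ hρ => ?_
  have : (ρ : ℂ) ∉ P := fun h => hρ (hL ρ h)
  simp only [Set.indicator_of_notMem this]

/-- The zeros on the line `ℝ·w₀` through a fixed off-line zero `ρ₀` (`w₀ = ρ₀ − ½`, `Re w₀ > 0`)
are finitely many (their ordinates are bounded by `Im ρ₀/(2 Re w₀)`). [folklore] -/
theorem finite_line_zeros {ρ₀ : ℂ} (ha₀ : 1 / 2 < ρ₀.re) (hg₀ : 0 < ρ₀.im) :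
    {ρ : 𝒵 | ∃ c : ℝ, (ρ : ℂ) - 1 / 2 = (c : ℂ) * (ρ₀ - 1 / 2)}.Finite := by
  set a₀ : ℝ := ρ₀.re - 1 / 2 with ha₀def
  have ha₀pos : 0 < a₀ := by rw [ha₀def]; linarith
  refine (finite_zeros_abs_im_le (ρ₀.im / (2 * a₀))).subset fun ρ hρ => ?_
  obtain ⟨c, hc⟩ := hρ
  have hre : (ρ : ℂ).re - 1 / 2 = c * a₀ := by
    have := congrArg Complex.re hc; simp [ha₀def] at this ⊢; linarith
  have him : (ρ : ℂ).im = c * ρ₀.im := by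
    have := congrArg Complex.im hc; simpa using this
  have hb : |(ρ : ℂ).re - 1 / 2| ≤ 1 / 2 := by
    simpa [sub_re] using abs_re_sub_half_le ρ.2
  rw [hre, abs_mul, abs_of_pos ha₀pos] at hb
  show |(ρ : ℂ).im| ≤ ρ₀.im / (2 * a₀)
  rw [him, abs_mul, abs_of_pos hg₀, le_div_iff₀ (by positivity)]
  nlinarith

/-- **Registered form `offline_least_ratio`** (crux stmt-RiemannHypothesis-11229, T2 component): the least
normalised ratio of an off-line zero and the gap above it. [folklore] -/
theorem offline_least_ratio :
    ∀ ρ : ℂ, ρ ∈ ZetaZeros.riemannZetaNontrivialZeros → ρ.re ≠ 1 / 2 → ∃ ρ₀ : ℂ, ρ₀ ∈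
    ZetaZeros.riemannZetaNontrivialZeros ∧ 1 / 2 < ρ₀.re ∧ 0 < ρ₀.im ∧ (∀ ρ' : ℂ, ρ' ∈
    ZetaZeros.riemannZetaNontrivialZeros → 1 / 2 < ρ'.re → 0 < ρ'.im → ρ₀.im / (ρ₀.re - 1 / 2) ≤
    ρ'.im / (ρ'.re - 1 / 2)) ∧ ∃ r₁ : ℝ, ρ₀.im / (ρ₀.re - 1 / 2) < r₁ ∧ ∀ ρ' : ℂ, ρ' ∈
    ZetaZeros.riemannZetaNontrivialZeros → 1 / 2 < ρ'.re → 0 < ρ'.im → ¬ (ρ₀.im / (ρ₀.re - 1 / 2) <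
    ρ'.im / (ρ'.re - 1 / 2) ∧ ρ'.im / (ρ'.re - 1 / 2) < r₁) :=
  fun _ hρ hoff => exists_least_ratio hρ hoff

end Summit.RiemannHypothesis.RiemannHypothesis.Theorems.WeilCombBohrFejer

end
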